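import Summits.Ventures.LatticeQCDFlow.Scaling.SwapSpacingOptimum
import Summits.Ventures.LatticeQCDFlow.Scaling.SwapSpacingBrackets

/-!
HONEST FRAMING: exact (Metropolis-corrected) sampling algorithms for lattice gauge theory; figures
of merit are autocorrelation/cost numbers at stated couplings and volumes; no continuum-physics
claim.

# SwapSpacingOptimumDEO — THE DEO-MODEL PAIR EFFICIENCY `u²·erfc u/erf u` (THE DRIVER's DETERMINISTIC
# EVEN–ODD SCHEME, LEADING ORDER IN THE TOTAL STIFFNESS): ITS DERIVATIVES, AND CERTIFIED SIGNS OF THE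
# CRITICAL AND CURVATURE FUNCTIONS AT `u = 0.55, 0.65` AND ON `[0.55, 1]` (row 22 `su3-ptbc`, GEN-5, ours;
# part 1 of 2 — the unique maximiser `uDeo ∈ (0.58, 0.63)`, i.e. optimal DEO-model acceptance
# `≈ 0.37–0.41`, is the sequel `SwapAcceptanceOptimumDEO`)

Venture `LatticeQCDFlow` (cell pub-lqcd), topic `Scaling`; FANOUT row 22 (`su3-ptbc`).  NEW WORK of the cell =
elementary calculus over GEN-4's `SwapSpacingOptimum` (`erf`, `erfc`, `hasDerivAt_erf(c)`, `strictAnti_erfc`,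
`erfc_lt_one_of_pos`) and `SwapSpacingBrackets` (`partialSum_even_le_erf` / `erf_le_partialSum_odd`, the
`2/√π` brackets), plus Mathlib's `Real.sum_le_exp_of_nonneg` / `Real.exp_bound'`.  Nothing is cited as a fact;
no `native_decide`, no interval engine.

THE MODEL (stated, not claimed for PTBC).  GEN-5's `SwapLadderRoundTripDEO`: under the deterministic even–odd
scheme (row 22's driver) the idealised round trip of a `K`-interval ladder with flat acceptance `a` is
`2(K+1)(1 + K(1−a)/a)` scans; all `K+1` replicas circulate at once and one scan costs `∝ K+1` sweeps, so the
cost per delivered round trip is `∝ E[T]` scans; with `K = Λ/ℓ`, `ℓ = 2√2·u`, `a = erfc u` (model (M1)) the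
leading order in `Λ` is `∝ Λ²·(1 − erfc u)/(u² erfc u)` — against `Λ²/(u² erfc u)` for the reversible
scheme (GEN-4's `swapEff`, optimum `a⋆ ≈ 0.234`).  We maximise `deoEff u = u²·erfc u/erf u`.

* §1 `gaussE u = (2/√π)e^{−u²}` (`= erf′`), `deoEff`, `deoCrit u = 2·erf u·erfc u − u·gaussE u`
  (`hasDerivAt_deoEff`: `deoEff′ = u·deoCrit/erf²` for `u > 0`), `deoCurv u = 1 − 4·erf u + 2u²`
  (`hasDerivAt_deoCrit`: `deoCrit′ = gaussE·deoCurv`), `hasDerivAt_deoCurv` (`= 4(u − gaussE u)`),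
  `strictMonoOn_sub_gaussE`;
* §2 certified brackets: `erf 0.55 ∈ (0.56329, 0.56333)`, `erf 0.65 ∈ (0.64191, 0.64204)`, `erf 0.8 > 0.7414`,
  `erf 0.9 > 0.7951`, `gaussE 0.55 ∈ (0.8229, 0.83386)`, `gaussE 0.65 ≥ 0.7395`; hence
  **`deoCrit_055_pos`**, **`deoCrit_065_neg`**, `deoCurv_le_of_mem`, **`deoCurv_neg_mid`** (`[0.55, 0.65]`),
  **`deoCurv_neg_right`** (`[0.65, 1]`), `deoCurv_055_neg`.

NOT CLAIMED here: the maximiser (sequel); that the model describes PTBC; any number of a run.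
-/

noncomputable section

open Real Set
open Literature.Analysis.SpecialFunctions (erf erfTerm)
open Literature.ComputerArithmetic.BrentZimmermann2010.AsymptoticExpansions (erfc erfc_pos)

namespace Summit.Ventures.LatticeQCDFlow.Scaling

/-! ## §1 The objective and its derivatives -/

section Defs

/-- `erf′(u) = (2/√π)e^{−u²}`, named. [folklore] -/
def gaussE (u : ℝ) : ℝ := 2 / sqrt π * exp (-(u ^ 2))

/-- `gaussE > 0`. [folklore] -/
theorem gaussE_pos (u : ℝ) : 0 < gaussE u := by unfold gaussE; positivity

/-- `erf = 1 − erfc`. [folklore] -/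
theorem erf_eq_one_sub_erfc (u : ℝ) : erf u = 1 - erfc u := by
  show erf u = 1 - (1 - erf u); ring

/-- `erf u > 0` for `u > 0`. [folklore] -/
theorem erf_pos_of_pos {u : ℝ} (hu : 0 < u) : 0 < erf u := by
  rw [erf_eq_one_sub_erfc]; linarith [erfc_lt_one_of_pos hu]

/-- `erf u < 1`. [folklore] -/
theorem erf_lt_one (u : ℝ) : erf u < 1 := by
  rw [erf_eq_one_sub_erfc]; linarith [erfc_pos u]

/-- **The DEO-model pair efficiency** `deoEff u = u²·erfc u/erf u` (reciprocal of the leading-order cost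
`(1 − erfc u)/(u² erfc u)`). [ours] -/
def deoEff (u : ℝ) : ℝ := u ^ 2 * erfc u / erf u

/-- **The critical function** `deoCrit u = 2·erf u·erfc u − u·(2/√π)e^{−u²}`. [ours] -/
def deoCrit (u : ℝ) : ℝ := 2 * erf u * erfc u - u * gaussE u

/-- **The curvature function** `deoCurv u = 1 − 4·erf u + 2u²` (`deoCrit′ = gaussE·deoCurv`). [ours] -/
def deoCurv (u : ℝ) : ℝ := 1 - 4 * erf u + 2 * u ^ 2

/-- `gaussE′(u) = −2u·gaussE u`. [folklore] -/
theorem hasDerivAt_gaussE (u : ℝ) : HasDerivAt gaussE (-(2 * u) * gaussE u) u := by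
  have h0 : HasDerivAt (fun v : ℝ => v ^ 2) (2 * u) u := by simpa using hasDerivAt_pow 2 u
  have h3 : HasDerivAt (fun v : ℝ => 2 / sqrt π * exp (-(v ^ 2)))
      (2 / sqrt π * (exp (-(u ^ 2)) * (-(2 * u)))) u := (h0.neg.exp).const_mul _
  have e1 : (fun v : ℝ => 2 / sqrt π * exp (-(v ^ 2))) = gaussE := rfl
  have e2 : 2 / sqrt π * (exp (-(u ^ 2)) * (-(2 * u))) = -(2 * u) * gaussE u := by
    unfold gaussE; ring
  rw [e1, e2] at h3
  exact h3

/-- `erf′ = gaussE`. [folklore] -/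
theorem hasDerivAt_erf' (u : ℝ) : HasDerivAt erf (gaussE u) u := hasDerivAt_erf u

/-- `erfc′ = −gaussE`. [folklore] -/
theorem hasDerivAt_erfc' (u : ℝ) : HasDerivAt erfc (-gaussE u) u := hasDerivAt_erfc u

/-- **`deoCrit′(u) = gaussE u · deoCurv u`.** [ours] -/
theorem hasDerivAt_deoCrit (u : ℝ) : HasDerivAt deoCrit (gaussE u * deoCurv u) u := by
  have h1 : HasDerivAt (fun v => 2 * erf v * erfc v)
      (2 * gaussE u * erfc u + 2 * erf u * (-gaussE u)) u :=
    ((hasDerivAt_erf' u).const_mul 2).mul (hasDerivAt_erfc' u)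
  have h2 : HasDerivAt (fun v => v * gaussE v) (1 * gaussE u + u * (-(2 * u) * gaussE u)) u :=
    (hasDerivAt_id' u).mul (hasDerivAt_gaussE u)
  have h : HasDerivAt (fun v => 2 * erf v * erfc v - v * gaussE v)
      (2 * gaussE u * erfc u + 2 * erf u * (-gaussE u) - (1 * gaussE u + u * (-(2 * u) * gaussE u))) u :=
    h1.sub h2
  have e : (fun v => 2 * erf v * erfc v - v * gaussE v) = deoCrit := rfl
  rw [e] at h
  convert h using 1
  unfold deoCurv
  rw [erf_eq_one_sub_erfc]
  ring

/-- **`deoCurv′(u) = 4·(u − gaussE u)`.** [ours] -/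
theorem hasDerivAt_deoCurv (u : ℝ) : HasDerivAt deoCurv (4 * (u - gaussE u)) u := by
  have h0 : HasDerivAt (fun v : ℝ => v ^ 2) (2 * u) u := by simpa using hasDerivAt_pow 2 u
  have h : HasDerivAt (fun v => 1 - 4 * erf v + 2 * v ^ 2) (0 - 4 * gaussE u + 2 * (2 * u)) u :=
    ((hasDerivAt_const u (1 : ℝ)).sub ((hasDerivAt_erf' u).const_mul 4)).add (h0.const_mul 2)
  have e : (fun v => 1 - 4 * erf v + 2 * v ^ 2) = deoCurv := rfl
  rw [e] at h
  convert h using 1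
  ring

/-- **`deoEff′(u) = u·deoCrit u/(erf u)²`** for `u > 0`. [ours] -/
theorem hasDerivAt_deoEff {u : ℝ} (hu : 0 < u) : HasDerivAt deoEff (u * deoCrit u / erf u ^ 2) u := by
  have hB : erf u ≠ 0 := (erf_pos_of_pos hu).ne'
  have h0 : HasDerivAt (fun v : ℝ => v ^ 2) (2 * u) u := by simpa using hasDerivAt_pow 2 u
  have h1 : HasDerivAt (fun v => v ^ 2 * erfc v) (2 * u * erfc u + u ^ 2 * (-gaussE u)) u :=
    h0.mul (hasDerivAt_erfc' u)
  have h : HasDerivAt (fun v => v ^ 2 * erfc v / erf v)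
      (((2 * u * erfc u + u ^ 2 * (-gaussE u)) * erf u - u ^ 2 * erfc u * gaussE u) / erf u ^ 2) u :=
    h1.div (hasDerivAt_erf' u) hB
  have e : (fun v => v ^ 2 * erfc v / erf v) = deoEff := rfl
  rw [e] at h
  convert h using 1
  unfold deoCrit
  rw [erf_eq_one_sub_erfc]
  field_simp
  ring

/-- `u − gaussE u` is strictly increasing on `[0, ∞)` (derivative `1 + 2u·gaussE u ≥ 1`). [ours] -/
theorem strictMonoOn_sub_gaussE : StrictMonoOn (fun u : ℝ => u - gaussE u) (Ici 0) := by
  have hd : ∀ u, HasDerivAt (fun v : ℝ => v - gaussE v) (1 - (-(2 * u) * gaussE u)) u := fun u =>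
    (hasDerivAt_id' u).sub (hasDerivAt_gaussE u)
  refine strictMonoOn_of_deriv_pos (convex_Ici 0)
    (fun u _ => (hd u).continuousAt.continuousWithinAt) fun u hu => ?_
  rw [interior_Ici] at hu
  rw [(hd u).deriv]
  have : 0 < u := hu
  nlinarith [gaussE_pos u]

end Defs

/-! ## §2 Certified brackets at `u = 0.55, 0.65, 0.8, 0.9` -/

section Brackets

/-- `gaussE` is antitone on `[0, ∞)`. [folklore] -/
theorem gaussE_antitoneOn : AntitoneOn gaussE (Ici 0) := by
  intro a ha b _ hab
  unfold gaussE
  have h : exp (-(b ^ 2)) ≤ exp (-(a ^ 2)) := exp_le_exp.mpr (by have : (0:ℝ) ≤ a := ha; nlinarith)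
  exact mul_le_mul_of_nonneg_left h (by positivity)

/-- `gaussE u = (2/√π)/e^{u²}`. [folklore] -/
theorem gaussE_eq_div (u : ℝ) : gaussE u = 2 / sqrt π / exp (u ^ 2) := by
  unfold gaussE; rw [Real.exp_neg]; ring

/-- Four Maclaurin terms of `erf` at `0.55`. [ours] -/
theorem erf_partialSum_055_even : ∑ i ∈ Finset.range (2 * 2), (-1 : ℝ) ^ i * erfTerm (11 / 20) i
    = 8945879503 / 17920000000 := by
  simp only [erfTerm, Finset.sum_range_succ, Finset.sum_range_zero]; norm_num [Nat.factorial]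

/-- Five Maclaurin terms of `erf` at `0.55`. [ours] -/
theorem erf_partialSum_055_odd : ∑ i ∈ Finset.range (2 * 2 + 1), (-1 : ℝ) ^ i * erfTerm (11 / 20) i
    = 386478500163437 / 774144000000000 := by
  simp only [erfTerm, Finset.sum_range_succ, Finset.sum_range_zero]; norm_num [Nat.factorial]

/-- Four Maclaurin terms of `erf` at `0.65`. [ours] -/
theorem erf_partialSum_065_even : ∑ i ∈ Finset.range (2 * 2), (-1 : ℝ) ^ i * erfTerm (13 / 20) i
    = 10194581241 / 17920000000 := by
  simp only [erfTerm, Finset.sum_range_succ, Finset.sum_range_zero]; norm_num [Nat.factorial]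

/-- Five Maclaurin terms of `erf` at `0.65`. [ours] -/
theorem erf_partialSum_065_odd : ∑ i ∈ Finset.range (2 * 2 + 1), (-1 : ℝ) ^ i * erfTerm (13 / 20) i
    = 440480141106811 / 774144000000000 := by
  simp only [erfTerm, Finset.sum_range_succ, Finset.sum_range_zero]; norm_num [Nat.factorial]

/-- Four Maclaurin terms of `erf` at `0.8`. [ours] -/
theorem erf_partialSum_08_even : ∑ i ∈ Finset.range (2 * 2), (-1 : ℝ) ^ i * erfTerm (4 / 5) i
    = 359356 / 546875 := by
  simp only [erfTerm, Finset.sum_range_succ, Finset.sum_range_zero]; norm_num [Nat.factorial]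

/-- Four Maclaurin terms of `erf` at `0.9`. [ours] -/
theorem erf_partialSum_09_even : ∑ i ∈ Finset.range (2 * 2), (-1 : ℝ) ^ i * erfTerm (9 / 10) i
    = 98652537 / 140000000 := by
  simp only [erfTerm, Finset.sum_range_succ, Finset.sum_range_zero]; norm_num [Nat.factorial]

/-- **`erf 0.55 > 0.56329`.** [ours] -/
theorem erf_055_gt : (0.56329 : ℝ) < erf (11 / 20) := by
  have h := partialSum_even_le_erf (x := 11 / 20) (by norm_num) (by norm_num) 2
  rw [erf_partialSum_055_even] at h
  have h2 : (1.12836 : ℝ) * (8945879503 / 17920000000) ≤ 2 / sqrt π * (8945879503 / 17920000000) :=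
    mul_le_mul_of_nonneg_right lt_two_div_sqrt_pi.le (by norm_num)
  norm_num at h2 ⊢; linarith

/-- `erf 0.55 < 0.56333`. [ours] -/
theorem erf_055_lt : erf (11 / 20) < (0.56333 : ℝ) := by
  have h := erf_le_partialSum_odd (x := 11 / 20) (by norm_num) (by norm_num) 2
  rw [erf_partialSum_055_odd] at h
  have h2 : 2 / sqrt π * (386478500163437 / 774144000000000 : ℝ)
      ≤ 1.128382 * (386478500163437 / 774144000000000) :=
    mul_le_mul_of_nonneg_right two_div_sqrt_pi_lt.le (by norm_num)
  norm_num at h2 ⊢; linarith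

/-- **`erf 0.65 > 0.64191`.** [ours] -/
theorem erf_065_gt : (0.64191 : ℝ) < erf (13 / 20) := by
  have h := partialSum_even_le_erf (x := 13 / 20) (by norm_num) (by norm_num) 2
  rw [erf_partialSum_065_even] at h
  have h2 : (1.12836 : ℝ) * (10194581241 / 17920000000) ≤ 2 / sqrt π * (10194581241 / 17920000000) :=
    mul_le_mul_of_nonneg_right lt_two_div_sqrt_pi.le (by norm_num)
  norm_num at h2 ⊢; linarith

/-- `erf 0.65 < 0.64204`. [ours] -/
theorem erf_065_lt : erf (13 / 20) < (0.64204 : ℝ) := by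
  have h := erf_le_partialSum_odd (x := 13 / 20) (by norm_num) (by norm_num) 2
  rw [erf_partialSum_065_odd] at h
  have h2 : 2 / sqrt π * (440480141106811 / 774144000000000 : ℝ)
      ≤ 1.128382 * (440480141106811 / 774144000000000) :=
    mul_le_mul_of_nonneg_right two_div_sqrt_pi_lt.le (by norm_num)
  norm_num at h2 ⊢; linarith

/-- `erf 0.8 > 0.7414`. [ours] -/
theorem erf_08_gt : (0.7414 : ℝ) < erf (4 / 5) := by
  have h := partialSum_even_le_erf (x := 4 / 5) (by norm_num) (by norm_num) 2
  rw [erf_partialSum_08_even] at h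
  have h2 : (1.12836 : ℝ) * (359356 / 546875) ≤ 2 / sqrt π * (359356 / 546875) :=
    mul_le_mul_of_nonneg_right lt_two_div_sqrt_pi.le (by norm_num)
  norm_num at h2 ⊢; linarith

/-- `erf 0.9 > 0.7951`. [ours] -/
theorem erf_09_gt : (0.7951 : ℝ) < erf (9 / 10) := by
  have h := partialSum_even_le_erf (x := 9 / 10) (by norm_num) (by norm_num) 2
  rw [erf_partialSum_09_even] at h
  have h2 : (1.12836 : ℝ) * (98652537 / 140000000) ≤ 2 / sqrt π * (98652537 / 140000000) :=
    mul_le_mul_of_nonneg_right lt_two_div_sqrt_pi.le (by norm_num)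
  norm_num at h2 ⊢; linarith

/-- `e^{0.55²} ≥ 1.35321` (five Taylor terms). [ours] -/
theorem exp_055_sq_ge : (1.35321 : ℝ) ≤ exp ((11 / 20 : ℝ) ^ 2) := by
  have h := Real.sum_le_exp_of_nonneg (x := (11 / 20 : ℝ) ^ 2) (by positivity) 5
  have hS : ∑ i ∈ Finset.range 5, ((11 / 20 : ℝ) ^ 2) ^ i / (i.factorial : ℝ) = 831415576481 / 614400000000 := by
    simp only [Finset.sum_range_succ, Finset.sum_range_zero]; norm_num [Nat.factorial]
  rw [hS] at h; norm_num at h ⊢; linarith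

/-- `e^{0.55²} ≤ 1.37113` (two Taylor terms with remainder). [ours] -/
theorem exp_055_sq_le : exp ((11 / 20 : ℝ) ^ 2) ≤ (1.37113 : ℝ) := by
  have h := Real.exp_bound' (x := (11 / 20 : ℝ) ^ 2) (by positivity) (by norm_num) (n := 2) (by norm_num)
  have hS : ∑ i ∈ Finset.range 2, ((11 / 20 : ℝ) ^ 2) ^ i / (i.factorial : ℝ) = 1 + 121 / 400 := by
    simp only [Finset.sum_range_succ, Finset.sum_range_zero]; norm_num [Nat.factorial]
  rw [hS] at h; norm_num [Nat.factorial] at h ⊢; linarith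

/-- `e^{0.65²} ≤ 1.525786` (five Taylor terms with remainder). [ours] -/
theorem exp_065_sq_le : exp ((13 / 20 : ℝ) ^ 2) ≤ (1.525786 : ℝ) := by
  have h := Real.exp_bound' (x := (13 / 20 : ℝ) ^ 2) (by positivity) (by norm_num) (n := 5) (by norm_num)
  have hS : ∑ i ∈ Finset.range 5, ((13 / 20 : ℝ) ^ 2) ^ i / (i.factorial : ℝ)
      = 1 + 169 / 400 + (169 / 400) ^ 2 / 2 + (169 / 400) ^ 3 / 6 + (169 / 400) ^ 4 / 24 := by
    simp only [Finset.sum_range_succ, Finset.sum_range_zero]; norm_num [Nat.factorial]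
  rw [hS] at h; norm_num [Nat.factorial] at h ⊢; linarith

/-- **`gaussE 0.55 ≤ 0.83386`.** [ours] -/
theorem gaussE_055_le : gaussE (11 / 20) ≤ (0.83386 : ℝ) := by
  rw [gaussE_eq_div, div_le_iff₀ (exp_pos _)]
  have h1 := two_div_sqrt_pi_lt
  have h2 := exp_055_sq_ge
  nlinarith

/-- **`gaussE 0.55 > 0.8229`** (in particular `> 0.55`). [ours] -/
theorem gaussE_055_gt : (0.8229 : ℝ) < gaussE (11 / 20) := by
  rw [gaussE_eq_div, lt_div_iff₀ (exp_pos _)]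
  have h1 := lt_two_div_sqrt_pi
  have h2 := exp_055_sq_le
  nlinarith

/-- **`gaussE 0.65 ≥ 0.7395`.** [ours] -/
theorem gaussE_065_ge : (0.7395 : ℝ) ≤ gaussE (13 / 20) := by
  rw [gaussE_eq_div, le_div_iff₀ (exp_pos _)]
  have h1 := lt_two_div_sqrt_pi
  have h2 := exp_065_sq_le
  nlinarith

/-- **`deoCrit 0.55 > 0`** (`2·erf·erfc ≥ 2·0.56333·0.43667`, `0.55·gaussE ≤ 0.55·0.83386`). [ours] -/
theorem deoCrit_055_pos : 0 < deoCrit (11 / 20) := by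
  unfold deoCrit
  rw [show erfc (11 / 20 : ℝ) = 1 - erf (11 / 20) from rfl]
  have h1 := erf_055_gt
  have h2 := erf_055_lt
  have h3 := gaussE_055_le
  have h4 := gaussE_pos (11 / 20)
  nlinarith

/-- **`deoCrit 0.65 < 0`** (`2·erf·erfc ≤ 2·0.64191·0.35809`, `0.65·gaussE ≥ 0.65·0.7395`). [ours] -/
theorem deoCrit_065_neg : deoCrit (13 / 20) < 0 := by
  unfold deoCrit
  rw [show erfc (13 / 20 : ℝ) = 1 - erf (13 / 20) from rfl]
  have h1 := erf_065_gt
  have h2 := erf_065_lt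
  have h3 := gaussE_065_ge
  nlinarith

/-- **Interval bound for the curvature function**: for `a ≤ u ≤ b` (`0 ≤ a`),
`deoCurv u ≤ 1 − 4·erf a + 2b²`. [ours] -/
theorem deoCurv_le_of_mem {a b u : ℝ} (ha : 0 ≤ a) (hau : a ≤ u) (hub : u ≤ b) :
    deoCurv u ≤ 1 - 4 * erf a + 2 * b ^ 2 := by
  unfold deoCurv
  have h1 : erf a ≤ erf u := by
    rw [erf_eq_one_sub_erfc, erf_eq_one_sub_erfc]; linarith [strictAnti_erfc.antitone hau]
  have h2 : u ^ 2 ≤ b ^ 2 := by nlinarith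
  linarith

/-- **`deoCurv < 0` on `[0.55, 0.65]`.** [ours] -/
theorem deoCurv_neg_mid {u : ℝ} (h1 : 11 / 20 ≤ u) (h2 : u ≤ 13 / 20) : deoCurv u < 0 := by
  have h := deoCurv_le_of_mem (by norm_num) h1 h2
  have he := erf_055_gt
  nlinarith

/-- **`deoCurv < 0` on `[0.65, 1]`** (three sub-intervals `[0.65,0.8]`, `[0.8,0.9]`, `[0.9,1]`). [ours] -/
theorem deoCurv_neg_right {u : ℝ} (h1 : 13 / 20 ≤ u) (h2 : u ≤ 1) : deoCurv u < 0 := by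
  rcases le_or_gt u (4 / 5) with ha | ha
  · have h := deoCurv_le_of_mem (by norm_num) h1 ha
    linarith [erf_065_gt]
  rcases le_or_gt u (9 / 10) with hb | hb
  · have h := deoCurv_le_of_mem (by norm_num) ha.le hb
    linarith [erf_08_gt]
  · have h := deoCurv_le_of_mem (by norm_num) hb.le h2
    linarith [erf_09_gt]

/-- `deoCurv 0.55 < 0`. [ours] -/
theorem deoCurv_055_neg : deoCurv (11 / 20) < 0 := deoCurv_neg_mid le_rfl (by norm_num)

end Brackets

end Summit.Ventures.LatticeQCDFlow.Scaling

end
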